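import Literature.AlgebraicGeometry.ShimuraVarieties.UnitaryBallProjectiveMaps
import HarnessLib

/-!
# Finite systems of automorphic forms on `𝔹²`: separation, immersion, raising the weight

Second file of the assembly of **Shafarevich's theorem** for compact ball quotients (see
`UnitaryBallProjectiveMaps.lean`). A *system of weight `k`* is a finite set
`S : Finset (Ball → ℂ)` of holomorphic automorphic forms of the canonical cocycle of weight `k`
(`holFactorForms Δ (canonicalCocycle ℂ k)`); no new definition is introduced — the three conditions
used by the assembly are written out:

* *non-vanishing at `z`*: `∃ f ∈ S, f z ≠ 0`;
* *separation of `z, w`*: `∃ f ∈ S, ∃ g ∈ S, f z * g w ≠ f w * g z` (a non-zero `2 × 2` minor);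
* *immersion at `z`* (kernel form): non-vanishing and
  `∀ u μ, (∀ f ∈ S, D(extend f)(z) u = μ f z) → u = 0`.

PROVED here (theorems only):

* §6 **raising the weight** `S ↦ {f · h ^ j | f, h ∈ S}` (weight `k (j+1)`, `mem_of_mem_raise`)
  preserves the three conditions: `exists_ne_zero_raise`, `exists_sep_raise` (case analysis on the
  vanishing of `f, g` at `z, w`), `imm_raise` (Leibniz rule `fderiv_extend_mul_pow`);
* §7 **openness**: the immersion condition is open in `𝔹²` (`isOpen_setOf_imm`: it is the linear
  independence of the three continuously varying jet vectors, `linearIndependent_jets_iff` +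
  Mathlib's `isOpen_setOf_linearIndependent`), the separation condition is open in `𝔹² × 𝔹²`
  (`isOpen_setOf_sep`);
* §8 non-vanishing only depends on the orbit (`exists_ne_zero_smul_iff`); vectors with all minors
  zero are proportional (`exists_eq_mul_of_minors_eq_zero`).

References: I. R. Shafarevich, *Basic Algebraic Geometry 2* (1994), Ch. IX §3.2 (proof of the
Theorem: "raise the forms to a common weight"); P. Griffiths, J. Harris, *Principles of Algebraic
Geometry* (1978), Ch. 1 §4.

## Provenance

pub-hodgecm2 cell (COR-CM), LIT-FANOUT row D4 (c3), claim `D4-6-asm` (seat b06). Theorems only.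
-/

set_option autoImplicit false

noncomputable section

open scoped Manifold ContDiff Topology LinearAlgebra.Projectivization
open Set Filter MulAction
open Literature.Geometry.ComplexHyperbolic
open Literature.Geometry.ComplexHyperbolic.BallModel (U21 Ball nsq)
open Literature.NumberTheory.Automorphic.AutomorphyFactor

namespace Literature.AlgebraicGeometry.ShimuraVarieties

namespace BallProjective

open BallForms (holFactorForms canonicalCocycle canonicalFactor extend holomorphic ballSet
  canonicalFactor_ne_zero isOpen_ballSet)

variable {Δ : Subgroup U21}

/-! ### §6 Finite systems of forms: non-vanishing, separation, immersion; raising the weight -/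

section Systems

open scoped Classical

variable {k : ℕ}

/-- **Raising the weight**: for a system `S` of weight `k`, the products `f · h ^ j` (`f, h ∈ S`) form a
system of weight `k (j + 1)`. [cite: Shafarevich1994, Ch. IX §3.2 (proof of the Theorem)] -/
theorem mem_of_mem_raise {S : Finset (Ball → ℂ)}
    (hS : ∀ f ∈ S, f ∈ holFactorForms Δ (canonicalCocycle ℂ k)) (j : ℕ) :
    ∀ F ∈ (S ×ˢ S).image (fun p ↦ p.1 * p.2 ^ j),
      F ∈ holFactorForms Δ (canonicalCocycle ℂ (k * (j + 1))) := by
  intro F hF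
  obtain ⟨p, hp, rfl⟩ := Finset.mem_image.1 hF
  obtain ⟨h1, h2⟩ := Finset.mem_product.1 hp
  exact mul_pow_mem (hS _ h1) (hS _ h2)

/-- `f · h ^ j` belongs to the raised system. [cite: Shafarevich1994, Ch. IX §3.2, proof of the Theorem] -/
theorem mul_pow_mem_raise {S : Finset (Ball → ℂ)} (j : ℕ) {f h : Ball → ℂ} (hf : f ∈ S) (hh : h ∈ S) :
    f * h ^ j ∈ (S ×ˢ S).image (fun p ↦ p.1 * p.2 ^ j) :=
  Finset.mem_image.2 ⟨(f, h), Finset.mem_product.2 ⟨hf, hh⟩, rfl⟩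

/-- Raising preserves non-vanishing at a point: `(f · f ^ j)(z) = f(z)^{j+1} ≠ 0`. [cite: Shafarevich1994, Ch. IX §3.2, proof of the Theorem] -/
theorem exists_ne_zero_raise {S : Finset (Ball → ℂ)} (j : ℕ) {z : Ball} (h : ∃ f ∈ S, f z ≠ 0) :
    ∃ F ∈ (S ×ˢ S).image (fun p ↦ p.1 * p.2 ^ j), F z ≠ 0 := by
  obtain ⟨f, hf, hfz⟩ := h
  refine ⟨f * f ^ j, mul_pow_mem_raise j hf hf, ?_⟩
  simp only [Pi.mul_apply, Pi.pow_apply]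
  exact mul_ne_zero hfz (pow_ne_zero _ hfz)

/-- **Raising preserves the separation of two points**: if a `2 × 2` minor of the values of `S` at
`z, w` is non-zero, so is one of the raised system (case analysis on which of `f(z), f(w), h(z), h(w)`
vanish). [cite: Shafarevich1994, Ch. IX §3.2 (proof of the Theorem)] -/
theorem exists_sep_raise {S : Finset (Ball → ℂ)} (j : ℕ) {z w : Ball}
    (h : ∃ f ∈ S, ∃ g ∈ S, f z * g w ≠ f w * g z) :
    ∃ F ∈ (S ×ˢ S).image (fun p ↦ p.1 * p.2 ^ j), ∃ G ∈ (S ×ˢ S).image (fun p ↦ p.1 * p.2 ^ j),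
      F z * G w ≠ F w * G z := by
  obtain ⟨f, hf, g, hg, hne⟩ := h
  by_cases hfz : f z = 0
  · -- then `f w ≠ 0` and `g z ≠ 0`
    have hfw : f w ≠ 0 := by intro h0; apply hne; rw [hfz, h0, zero_mul, zero_mul]
    have hgz : g z ≠ 0 := by intro h0; apply hne; rw [hfz, h0, zero_mul, mul_zero]
    by_cases hgw : g w = 0
    · -- use `f^{j+1}`, `g^{j+1}`
      refine ⟨f * f ^ j, mul_pow_mem_raise j hf hf, g * g ^ j, mul_pow_mem_raise j hg hg, ?_⟩
      simp only [Pi.mul_apply, Pi.pow_apply, hfz, hgw, zero_mul]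
      exact (mul_ne_zero (mul_ne_zero hfw (pow_ne_zero _ hfw)) (mul_ne_zero hgz (pow_ne_zero _ hgz))).symm
    · -- `g` vanishes nowhere: use `f g^j`, `g g^j`
      refine ⟨f * g ^ j, mul_pow_mem_raise j hf hg, g * g ^ j, mul_pow_mem_raise j hg hg, ?_⟩
      simp only [Pi.mul_apply, Pi.pow_apply]
      intro heq
      apply hne
      have hu : (g z ^ j * g w ^ j) ≠ 0 := mul_ne_zero (pow_ne_zero _ hgz) (pow_ne_zero _ hgw)
      have : (f z * g w - f w * g z) * (g z ^ j * g w ^ j) = 0 := by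
        have := sub_eq_zero.2 heq
        linear_combination this
      rcases mul_eq_zero.1 this with h0 | h0
      · exact sub_eq_zero.1 h0
      · exact absurd h0 hu
  · by_cases hfw : f w = 0
    · -- then `g w ≠ 0`; if moreover `g z = 0` use powers, else `g` vanishes nowhere
      have hgw : g w ≠ 0 := by intro h0; apply hne; rw [hfw, h0, mul_zero, zero_mul]
      by_cases hgz : g z = 0
      · refine ⟨f * f ^ j, mul_pow_mem_raise j hf hf, g * g ^ j, mul_pow_mem_raise j hg hg, ?_⟩
        simp only [Pi.mul_apply, Pi.pow_apply, hfw, hgz, zero_mul, mul_zero]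
        exact mul_ne_zero (mul_ne_zero hfz (pow_ne_zero _ hfz)) (mul_ne_zero hgw (pow_ne_zero _ hgw))
      · refine ⟨f * g ^ j, mul_pow_mem_raise j hf hg, g * g ^ j, mul_pow_mem_raise j hg hg, ?_⟩
        simp only [Pi.mul_apply, Pi.pow_apply]
        intro heq
        apply hne
        have hu : (g z ^ j * g w ^ j) ≠ 0 := mul_ne_zero (pow_ne_zero _ hgz) (pow_ne_zero _ hgw)
        have : (f z * g w - f w * g z) * (g z ^ j * g w ^ j) = 0 := by
          have := sub_eq_zero.2 heq
          linear_combination this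
        rcases mul_eq_zero.1 this with h0 | h0
        · exact sub_eq_zero.1 h0
        · exact absurd h0 hu
    · -- `f` vanishes at neither point: use `f f^j`, `g f^j`
      refine ⟨f * f ^ j, mul_pow_mem_raise j hf hf, g * f ^ j, mul_pow_mem_raise j hg hf, ?_⟩
      simp only [Pi.mul_apply, Pi.pow_apply]
      intro heq
      apply hne
      have hu : (f z ^ j * f w ^ j) ≠ 0 := mul_ne_zero (pow_ne_zero _ hfz) (pow_ne_zero _ hfw)
      have : (f z * g w - f w * g z) * (f z ^ j * f w ^ j) = 0 := by
        have := sub_eq_zero.2 heq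
        linear_combination this
      rcases mul_eq_zero.1 this with h0 | h0
      · exact sub_eq_zero.1 h0
      · exact absurd h0 hu

/-- The derivative of the zero extension of `f · h ^ j` at a ball point (Leibniz rule; the extensions
agree with the products of extensions on the open ball). [cite: Shafarevich1994, Ch. IX §3.2, proof of the Theorem ("The verification of (B) is similar")] -/
theorem fderiv_extend_mul_pow {f h : Ball → ℂ} (hf : f ∈ holomorphic ℂ) (hh : h ∈ holomorphic ℂ)
    (j : ℕ) (z : Ball) (u : Fin 2 → ℂ) :
    fderiv ℂ (extend ℂ (f * h ^ j)) z.1 u =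
      h z ^ j * fderiv ℂ (extend ℂ f) z.1 u +
        f z * ((j : ℂ) * h z ^ (j - 1) * fderiv ℂ (extend ℂ h) z.1 u) := by
  have hev : extend ℂ (f * h ^ j) =ᶠ[𝓝 z.1] fun w ↦ extend ℂ f w * extend ℂ h w ^ j := by
    filter_upwards [isOpen_ballSet.mem_nhds (BallForms.coe_mem_ballSet z)] with w hw
    have hw' : nsq w < 1 := hw
    simp only [BallForms.extend, dif_pos hw', Pi.mul_apply, Pi.pow_apply]
  have hdf := (BallForms.differentiableAt_extend hf z).hasFDerivAt
  have hdh := (BallForms.differentiableAt_extend hh z).hasFDerivAt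
  have hprod := (hdf.mul (hdh.pow j)).congr_of_eventuallyEq hev
  rw [hprod.fderiv]
  simp only [_root_.add_apply, FunLike.coe_smul, Pi.smul_apply, smul_eq_mul,
    BallForms.extend_apply_coe, nsmul_eq_mul]
  ring

/-- **Raising preserves the immersion condition** (kernel form): if `dF(z)u = μ F(z)` for every `F` in the
raised system and some `b ∈ S` has `b(z) ≠ 0`, then, reading it on `b^{j+1}` and on the `f b^j`,
`df(z)u = (μ/(j+1)) f(z)` for all `f ∈ S`. [cite: Shafarevich1994, Ch. IX §3.2 (proof of the Theorem)] -/
theorem imm_raise {S : Finset (Ball → ℂ)} (hS : ∀ f ∈ S, f ∈ holomorphic ℂ) (j : ℕ) {z : Ball}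
    (hnz : ∃ f ∈ S, f z ≠ 0)
    (himm : ∀ (u : Fin 2 → ℂ) (μ : ℂ), (∀ f ∈ S, fderiv ℂ (extend ℂ f) z.1 u = μ * f z) → u = 0)
    (u : Fin 2 → ℂ) (μ : ℂ)
    (hu : ∀ F ∈ (S ×ˢ S).image (fun p ↦ p.1 * p.2 ^ j), fderiv ℂ (extend ℂ F) z.1 u = μ * F z) :
    u = 0 := by
  obtain ⟨b, hb, hbz⟩ := hnz
  have hj : ((j : ℂ) + 1) ≠ 0 := by exact_mod_cast Nat.succ_ne_zero j
  set ν : ℂ := μ / ((j : ℂ) + 1) with hν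
  have hμ : μ = ((j : ℂ) + 1) * ν := by rw [hν]; field_simp
  -- `j · (c · c^{j-1}) = j · c^j` (trivial for `j = 0`)
  have hpowj : (j : ℂ) * (b z * b z ^ (j - 1)) = (j : ℂ) * b z ^ j := by
    rcases Nat.eq_zero_or_pos j with rfl | hjpos
    · simp
    · rw [← pow_succ', Nat.sub_add_cancel hjpos]
  -- on `b · b^j`: `(j+1) b^j Db = μ b^{j+1}`, so `Db = ν · b z`
  have h1 := hu _ (mul_pow_mem_raise j hb hb)
  rw [fderiv_extend_mul_pow (hS b hb) (hS b hb) j z u] at h1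
  simp only [Pi.mul_apply, Pi.pow_apply] at h1
  have hDb : fderiv ℂ (extend ℂ b) z.1 u = ν * b z := by
    have key : ((j : ℂ) + 1) * b z ^ j * fderiv ℂ (extend ℂ b) z.1 u =
        ((j : ℂ) + 1) * b z ^ j * (ν * b z) := by
      linear_combination h1 - (fderiv ℂ (extend ℂ b) z.1 u) * hpowj + (b z * b z ^ j) * hμ
    exact mul_left_cancel₀ (mul_ne_zero hj (pow_ne_zero j hbz)) key
  refine himm u ν fun f hf ↦ ?_
  have h2 := hu _ (mul_pow_mem_raise j hf hb)
  rw [fderiv_extend_mul_pow (hS f hf) (hS b hb) j z u] at h2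
  simp only [Pi.mul_apply, Pi.pow_apply] at h2
  have key : b z ^ j * fderiv ℂ (extend ℂ f) z.1 u = b z ^ j * (ν * f z) := by
    linear_combination h2 - (f z * j * b z ^ (j - 1)) * hDb + (f z * b z ^ j) * hμ - (ν * f z) * hpowj
  exact mul_left_cancel₀ (pow_ne_zero j hbz) key

end Systems


/-! ### §7 The immersion and separation conditions are open -/

section Openness

open scoped Classical

/-- The three *jet vectors* of a system at `z` — values, and derivatives along the two coordinate
directions — are linearly independent iff the system does not vanish simultaneously at `z` and its
differential there has the immersion property (kernel form). [cite: Shafarevich1994, Ch. IX §1.3, Proposition (condition (B))] -/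
theorem linearIndependent_jets_iff {S : Finset (Ball → ℂ)} (z : Ball) :
    LinearIndependent ℂ (![fun f : S ↦ f.1 z,
        fun f : S ↦ fderiv ℂ (extend ℂ f.1) z.1 (Pi.single 0 1),
        fun f : S ↦ fderiv ℂ (extend ℂ f.1) z.1 (Pi.single 1 1)] : Fin 3 → S → ℂ) ↔
      (∃ f ∈ S, f z ≠ 0) ∧ ∀ (u : Fin 2 → ℂ) (μ : ℂ),
        (∀ f ∈ S, fderiv ℂ (extend ℂ f) z.1 u = μ * f z) → u = 0 := by
  have hdec : ∀ (f : Ball → ℂ) (u : Fin 2 → ℂ), fderiv ℂ (extend ℂ f) z.1 u =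
      u 0 * fderiv ℂ (extend ℂ f) z.1 (Pi.single 0 1) +
        u 1 * fderiv ℂ (extend ℂ f) z.1 (Pi.single 1 1) := by
    intro f u
    have hu : u = u 0 • (Pi.single 0 1 : Fin 2 → ℂ) + u 1 • (Pi.single 1 1 : Fin 2 → ℂ) := by
      ext i; fin_cases i <;> simp
    conv_lhs => rw [hu]
    rw [map_add, map_smul, map_smul, smul_eq_mul, smul_eq_mul]
  rw [Fintype.linearIndependent_iff]
  constructor
  · intro hli
    refine ⟨?_, fun u μ hu ↦ ?_⟩
    · by_contra hall
      push Not at hall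
      have h := hli (![1, 0, 0]) (by
        ext f
        simp [Fin.sum_univ_three, hall f.1 f.2])
      exact one_ne_zero (h 0)
    · have h := hli (![-μ, u 0, u 1]) (by
        ext f
        simp only [Fin.sum_univ_three, Finset.sum_apply, Pi.smul_apply, smul_eq_mul,
          Matrix.cons_val_zero, Matrix.cons_val_one, Matrix.cons_val, Pi.zero_apply]
        have := hu f.1 f.2
        rw [hdec] at this
        linear_combination this)
      ext i
      fin_cases i
      · exact h 1
      · exact h 2
  · rintro ⟨⟨f₀, hf₀, hf₀z⟩, himm⟩ g hg
    have hg' : ∀ f ∈ S, g 0 * f z + g 1 * fderiv ℂ (extend ℂ f) z.1 (Pi.single 0 1) +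
        g 2 * fderiv ℂ (extend ℂ f) z.1 (Pi.single 1 1) = 0 := by
      intro f hf
      have := congrFun hg ⟨f, hf⟩
      simpa [Fin.sum_univ_three] using this
    have hu : (![g 1, g 2] : Fin 2 → ℂ) = 0 := by
      refine himm ![g 1, g 2] (-g 0) fun f hf ↦ ?_
      rw [hdec]
      simp only [Matrix.cons_val_zero, Matrix.cons_val_one]
      linear_combination hg' f hf
    have h1 : g 1 = 0 := by simpa using congrFun hu 0
    have h2 : g 2 = 0 := by simpa using congrFun hu 1
    have h0 : g 0 = 0 := by
      have := hg' f₀ hf₀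
      rw [h1, h2, zero_mul, zero_mul, add_zero, add_zero] at this
      exact (mul_eq_zero.1 this).resolve_right hf₀z
    intro i
    fin_cases i <;> assumption

/-- The jet vectors of a system of holomorphic functions depend continuously on the point. [cite: Shafarevich1994, Ch. IX §3.2, proof of the Theorem (conditions (A), (B) are open)] -/
theorem continuous_jets {S : Finset (Ball → ℂ)} (hS : ∀ f ∈ S, f ∈ holomorphic ℂ) :
    Continuous fun z : Ball ↦ (![fun f : S ↦ f.1 z,
        fun f : S ↦ fderiv ℂ (extend ℂ f.1) z.1 (Pi.single 0 1),
        fun f : S ↦ fderiv ℂ (extend ℂ f.1) z.1 (Pi.single 1 1)] : Fin 3 → S → ℂ) := by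
  refine continuous_pi fun i ↦ ?_
  fin_cases i
  · exact continuous_pi fun f ↦ BallForms.continuous_of_mem_holomorphic (hS f.1 f.2)
  · exact continuous_pi fun f ↦ (continuous_fderiv_extend (hS f.1 f.2)).clm_apply continuous_const
  · exact continuous_pi fun f ↦ (continuous_fderiv_extend (hS f.1 f.2)).clm_apply continuous_const

/-- **The immersion condition is open**: the set of points where a system of holomorphic functions is
non-vanishing with injective projectivised differential is open in `𝔹²` (linear independence of the
continuously varying jet vectors). [cite: Shafarevich1994, Ch. IX §3.2, proof of the Theorem (conditions (A), (B) are open)] -/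
theorem isOpen_setOf_imm {S : Finset (Ball → ℂ)} (hS : ∀ f ∈ S, f ∈ holomorphic ℂ) :
    IsOpen {z : Ball | (∃ f ∈ S, f z ≠ 0) ∧ ∀ (u : Fin 2 → ℂ) (μ : ℂ),
      (∀ f ∈ S, fderiv ℂ (extend ℂ f) z.1 u = μ * f z) → u = 0} := by
  have h : {z : Ball | (∃ f ∈ S, f z ≠ 0) ∧ ∀ (u : Fin 2 → ℂ) (μ : ℂ),
      (∀ f ∈ S, fderiv ℂ (extend ℂ f) z.1 u = μ * f z) → u = 0} =
      (fun z : Ball ↦ (![fun f : S ↦ f.1 z,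
        fun f : S ↦ fderiv ℂ (extend ℂ f.1) z.1 (Pi.single 0 1),
        fun f : S ↦ fderiv ℂ (extend ℂ f.1) z.1 (Pi.single 1 1)] : Fin 3 → S → ℂ)) ⁻¹'
        {v | LinearIndependent ℂ v} := by
    ext z
    exact (linearIndependent_jets_iff z).symm
  rw [h]
  exact isOpen_setOf_linearIndependent.preimage (continuous_jets hS)

/-- **The separation condition is open** in `𝔹² × 𝔹²`. [cite: Shafarevich1994, Ch. IX §3.2, proof of the Theorem (conditions (A), (B) are open)] -/
theorem isOpen_setOf_sep {S : Finset (Ball → ℂ)} (hS : ∀ f ∈ S, f ∈ holomorphic ℂ) :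
    IsOpen {p : Ball × Ball | ∃ f ∈ S, ∃ g ∈ S, f p.1 * g p.2 ≠ f p.2 * g p.1} := by
  have h : {p : Ball × Ball | ∃ f ∈ S, ∃ g ∈ S, f p.1 * g p.2 ≠ f p.2 * g p.1} =
      ⋃ f ∈ S, ⋃ g ∈ S, {p : Ball × Ball | f p.1 * g p.2 ≠ f p.2 * g p.1} := by
    ext p; simp
  rw [h]
  refine isOpen_biUnion fun f hf ↦ isOpen_biUnion fun g hg ↦ ?_
  have hfc := BallForms.continuous_of_mem_holomorphic (hS f hf)
  have hgc := BallForms.continuous_of_mem_holomorphic (hS g hg)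
  exact isOpen_ne_fun ((hfc.comp continuous_fst).mul (hgc.comp continuous_snd))
    ((hfc.comp continuous_snd).mul (hgc.comp continuous_fst))

end Openness

/-! ### §8 Non-vanishing along orbits; non-proportional vectors have a non-zero minor -/

/-- Non-vanishing of a system of forms of one weight at a point only depends on the orbit. [cite: Shafarevich1994, Ch. IX §3.1, Definition (automorphic form of weight k)] -/
theorem exists_ne_zero_smul_iff {k : ℕ} {S : Finset (Ball → ℂ)}
    (hS : ∀ f ∈ S, f ∈ holFactorForms Δ (canonicalCocycle ℂ k)) (δ : Δ) (z : Ball) :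
    (∃ f ∈ S, f (δ • z) ≠ 0) ↔ ∃ f ∈ S, f z ≠ 0 := by
  constructor
  · rintro ⟨f, hf, hne⟩
    refine ⟨f, hf, fun h0 ↦ hne ?_⟩
    rw [apply_smul_eq (hS f hf) δ z, h0, mul_zero]
  · rintro ⟨f, hf, hne⟩
    refine ⟨f, hf, fun h0 ↦ hne ?_⟩
    rw [apply_eq_mul_apply_smul (hS f hf) δ z, h0, mul_zero]

/-- If every `2 × 2` minor of two vectors vanishes and the first is non-zero somewhere, the second is a
multiple of the first. [cite: Shafarevich1994, Ch. IX §1.3, Proposition (condition (A))] -/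
theorem exists_eq_mul_of_minors_eq_zero {ι : Type*} {a b : ι → ℂ} {i₀ : ι} (ha : a i₀ ≠ 0)
    (h : ∀ i j, a i * b j = a j * b i) : ∃ c : ℂ, ∀ i, b i = c * a i := by
  refine ⟨b i₀ / a i₀, fun i ↦ ?_⟩
  have := h i₀ i
  field_simp
  linear_combination this

end BallProjective

end Literature.AlgebraicGeometry.ShimuraVarieties

end
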